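import Literature.NumberTheory.Automorphic.PlaneLatticesSelfDualGlued            -- ★ p840702 (+ ★ p840624 (L5-a) Hermite currency, `zpow_uniformizer_mem_integer_iff`)
import Literature.NumberTheory.Automorphic.HeckeTransversalGL                    -- ★ `mem_glInt_of_isIntegralMatrix`, `IsIntegralMatrix`
import HarnessLib

/-!
# Plane lattices stable under a COMPANION matrix `!![0, −d; 1, t]` (an elliptic element of type (2) in its cyclic frame), in Hermite coordinates
# (Flicker 1998, §6 p. 97: the H-side count of the ramified torus; Mars' remark p. 95)

Topic `NumberTheory/Automorphic`; namespace `Literature.NumberTheory.Automorphic`.  THEOREMS ONLY (no definition, no instance, no notation, no named fact,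
no `sorry`).  Cell `pub/hodgecm-mathlib`, F0∕P3a road «D-N7-inert» ∕ MAP v3 (F11-d): brick **(β1)** of the TYPE-(2) H-side value `Φ^st_{1_{K_H}}(t) = phiHtwo q N`
(B-p10 (g24) CENSUS-F11d 036a766dbbf9cb18; LEAD T8-65).  HC_CM is proved only modulo the printed citations until rung 0 closes; this file is unconditional.

THE MATHEMATICS.  An element `γ₂ ∈ U(Φ₂)(L⁺_v)` whose characteristic polynomial `X² − tX + d` is IRREDUCIBLE over `E_v = L_w` has no eigenframe over `E_v`; in a CYCLIC frame
`(v, γ₂ v)` it is the companion matrix `C(t, d) = !![0, −d; 1, t]`.  A plane lattice in Hermite form `Λ(T(k, y, l))` (★ (L5-a)) is `C`-stable iff `T⁻¹ C T ∈ GL₂(𝒪)`, and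
`T⁻¹ C T = !![−y ϖ^{−l}, −ϖ^{−(k+l)}(y² + t y ϖ^l + d ϖ^{2l}); ϖ^{k−l}, y ϖ^{−l} + t]` — so (for `|d| = 1`, `t ∈ 𝒪`) iff
`l ≤ k`, `ϖ^{−l} y ∈ 𝒪` and `ϖ^{−(k+l)} · N(y, ϖ^l) ∈ 𝒪` where `N(y, z) = y² + t y z + d z²` is the NORM FORM of `E_v[γ₂] ∕ E_v` («`v_K(y′ + γ₂) ≥ k − l`», the
order∕conductor condition of Mars' remark in the ramified tower `R_m = 𝒪_E + ϖ^m 𝒪_K`).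

* §1 `upperTriangular_inv_mul_companion_mul` — the `2 × 2` identity (any field, `P Q ≠ 0`).
* §2 **`map_companion_span_eq_self_iff_of_hermite`** — the stability criterion.

## References
* [Flicker1998UnitaryFL] Y. Z. Flicker, *Elementary proof of the fundamental lemma for a unitary group*, Canad. J. Math. 50 (1998), §6 p. 95 REMARK, p. 97.
* [Macdonald1995] I. G. Macdonald, *Symmetric functions and Hall polynomials* (1995), Ch. V §2 (Hermite normal form).
-/

set_option autoImplicit false

noncomputable section

open scoped ValuativeRel Matrix MatrixGroups
open Matrix ValuativeRel

namespace Literature.NumberTheory.Automorphic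

variable {F : Type*} [Field F] [ValuativeRel F] {ϖ : F} (hϖ : IsUniformizingElement ϖ)

/-! ## §1 The conjugate of a companion matrix by an upper-triangular matrix -/

omit [ValuativeRel F] in
/-- `!![P, y; 0, Q]⁻¹ · !![0, −d; 1, t] · !![P, y; 0, Q] = !![−y Q⁻¹, −P⁻¹ Q⁻¹ (y² + t y Q + d Q²); P Q⁻¹, y Q⁻¹ + t]`. [cite: Macdonald1995, Ch. V §2] -/
theorem upperTriangular_inv_mul_companion_mul {P Q : F} (hP : P ≠ 0) (hQ : Q ≠ 0) (y t d : F) :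
    (!![P, y; 0, Q] : Matrix (Fin 2) (Fin 2) F)⁻¹ * !![0, -d; 1, t] * !![P, y; 0, Q] =
      !![-(y * Q⁻¹), -(P⁻¹ * Q⁻¹ * (y ^ 2 + t * y * Q + d * Q ^ 2)); P * Q⁻¹, y * Q⁻¹ + t] := by
  -- first product `T⁻¹ · C`
  have f11 : P⁻¹ * 0 + -(P⁻¹ * y * Q⁻¹) * 1 = -(P⁻¹ * y * Q⁻¹) := by ring
  have f12 : P⁻¹ * -d + -(P⁻¹ * y * Q⁻¹) * t = -(P⁻¹ * (d + y * Q⁻¹ * t)) := by ring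
  have f21 : (0 : F) * 0 + Q⁻¹ * 1 = Q⁻¹ := by ring
  have f22 : (0 : F) * -d + Q⁻¹ * t = Q⁻¹ * t := by ring
  -- second product `· T`
  have e11 : -(P⁻¹ * y * Q⁻¹) * P + -(P⁻¹ * (d + y * Q⁻¹ * t)) * 0 = -(y * Q⁻¹) := by
    field_simp
    ring
  have e12 : -(P⁻¹ * y * Q⁻¹) * y + -(P⁻¹ * (d + y * Q⁻¹ * t)) * Q = -(P⁻¹ * Q⁻¹ * (y ^ 2 + t * y * Q + d * Q ^ 2)) := by
    field_simp
    ring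
  have e21 : Q⁻¹ * P + Q⁻¹ * t * 0 = P * Q⁻¹ := by ring
  have e22 : Q⁻¹ * y + Q⁻¹ * t * Q = y * Q⁻¹ + t := by
    field_simp
  rw [upperTriangular_inv hP hQ, Matrix.mul_fin_two, f11, f12, f21, f22, Matrix.mul_fin_two, e11, e12, e21, e22]

/-! ## §2 Stability of a Hermite lattice under a companion matrix -/

include hϖ in
/-- **`C(t,d)`-STABILITY IN HERMITE COORDINATES** (`C = !![0, −d; 1, t]`, `|d| = 1`, `t ∈ 𝒪`): for `↑g = T(k, y, l) = !![ϖ^k, y; 0, ϖ^l]`,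
`C · Λ(g) = Λ(g) ↔ l ≤ k ∧ ϖ^{−l} y ∈ 𝒪 ∧ ϖ^{−(k+l)} (y² + t y ϖ^l + d ϖ^{2l}) ∈ 𝒪` — the last conjunct is the NORM-FORM condition «`N_{K∕E}(y + ϖ^l γ) ∈ ϖ^{k+l} 𝒪`» of the
quadratic algebra `K = E[γ]`, i.e. Mars' order condition in the ramified tower. [cite: Flicker1998UnitaryFL, §6 p. 95 REMARK, p. 97] [cite: Macdonald1995, Ch. V §2] -/
theorem map_companion_span_eq_self_iff_of_hermite {k l : ℤ} {y t d : F} (γ g : GL (Fin 2) F)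
    (hγ : (γ : Matrix (Fin 2) (Fin 2) F) = !![0, -d; 1, t]) (hd : valuation F d = 1) (ht : t ∈ 𝒪[F])
    (hg : (g : Matrix (Fin 2) (Fin 2) F) = !![ϖ ^ k, y; 0, ϖ ^ l]) :
    (Submodule.span 𝒪[F] (Set.range ((g : Matrix (Fin 2) (Fin 2) F))ᵀ)).map
        ((Matrix.toLin' (γ : Matrix (Fin 2) (Fin 2) F)).restrictScalars 𝒪[F]) =
      Submodule.span 𝒪[F] (Set.range ((g : Matrix (Fin 2) (Fin 2) F))ᵀ) ↔
      l ≤ k ∧ ϖ ^ (-l) * y ∈ 𝒪[F] ∧ ϖ ^ (-(k + l)) * (y ^ 2 + t * y * ϖ ^ l + d * ϖ ^ (2 * l)) ∈ 𝒪[F] := by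
  have h0 := hϖ.ne_zero
  have hm : ((g⁻¹ * γ * g : GL (Fin 2) F) : Matrix (Fin 2) (Fin 2) F) =
      !![-(y * (ϖ ^ l)⁻¹), -((ϖ ^ k)⁻¹ * (ϖ ^ l)⁻¹ * (y ^ 2 + t * y * ϖ ^ l + d * (ϖ ^ l) ^ 2)); ϖ ^ k * (ϖ ^ l)⁻¹, y * (ϖ ^ l)⁻¹ + t] := by
    rw [Units.val_mul, Units.val_mul, Matrix.coe_units_inv, hg, hγ, upperTriangular_inv_mul_companion_mul (zpow_ne_zero k h0) (zpow_ne_zero l h0)]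
  -- rewrite the powers of `ϖ`
  have hkl : ϖ ^ k * (ϖ ^ l)⁻¹ = ϖ ^ (k - l) := by rw [← _root_.zpow_neg, ← zpow_add₀ h0, sub_eq_add_neg]
  have hy' : y * (ϖ ^ l)⁻¹ = ϖ ^ (-l) * y := by rw [← _root_.zpow_neg, mul_comm]
  have hkl' : (ϖ ^ k)⁻¹ * (ϖ ^ l)⁻¹ = ϖ ^ (-(k + l)) := by rw [← _root_.zpow_neg, ← _root_.zpow_neg, ← zpow_add₀ h0, neg_add]
  have h2l : (ϖ ^ l) ^ 2 = ϖ ^ (2 * l) := by rw [← zpow_natCast, ← _root_.zpow_mul, mul_comm]; norm_num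
  rw [hkl', h2l, hkl, hy'] at hm
  rw [map_span_range_transpose_eq_self_iff]
  constructor
  · intro hmem
    have hent := (mem_glInt_iff (g⁻¹ * γ * g)).1 hmem
    have e21 : ϖ ^ (k - l) ∈ 𝒪[F] := by simpa [hm] using hent.1 1 0
    have e11 : -(ϖ ^ (-l) * y) ∈ 𝒪[F] := by simpa [hm] using hent.1 0 0
    have e12 : -(ϖ ^ (-(k + l)) * (y ^ 2 + t * y * ϖ ^ l + d * ϖ ^ (2 * l))) ∈ 𝒪[F] := by simpa [hm] using hent.1 0 1
    refine ⟨?_, by simpa using (𝒪[F]).neg_mem e11, by simpa using (𝒪[F]).neg_mem e12⟩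
    have := (zpow_uniformizer_mem_integer_iff hϖ (k - l)).1 e21
    omega
  · rintro ⟨hkl0, hy, hN⟩
    refine mem_glInt_of_isIntegralMatrix (fun i j => ?_) ?_
    · rw [hm]
      fin_cases i <;> fin_cases j
      · simpa using (𝒪[F]).neg_mem hy
      · simpa using (𝒪[F]).neg_mem hN
      · simpa using (zpow_uniformizer_mem_integer_iff hϖ (k - l)).2 (by omega)
      · simpa using (𝒪[F]).add_mem hy ht
    · -- `det (g⁻¹ γ g) = det γ = d`
      rw [Units.val_mul, Units.val_mul, Matrix.det_mul, Matrix.det_mul, Matrix.coe_units_inv, Matrix.det_nonsing_inv,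
        mul_comm (Ring.inverse _), mul_assoc, Ring.inverse_mul_cancel _ ((Matrix.isUnits_det_units g)), mul_one, hγ,
        Matrix.det_fin_two_of]
      simpa using hd

end Literature.NumberTheory.Automorphic

end
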